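import Summits.HubbardSuperconductivity.HubbardSuperconductivity.Theorems.ThermalWedgeTwCeilingGlue
import Summits.HubbardSuperconductivity.HubbardSuperconductivity.Theorems.ThermalWedgeTwSectorEnergyLowerBound
import Summits.HubbardSuperconductivity.HubbardSuperconductivity.Theorems.ThermalWedgeTwApproximatingHamiltonian

/-!
# Route `ThermalWedge` — target item `TwExponentialCeiling` (stmt-HubbardSuperconductivity-1704):
what it still depends on

With `TwSectorEnergyLowerBound` (stmt-1701), `TwApproximatingHamiltonian` (stmt-1703) and the glue
`TwCeilingGlue` (stmt-1705) proved, the exponential ceiling on the pure model's every-ground-state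
`d`-wave order is reduced to exactly two open inputs of the route: the pure-model thermal bound
`TwPureThermalBound` (stmt-1702; itself reduced to `T = 0` grand-canonical exposure in
`ThermalWedgeTwPureThermalBoundReduction.lean`) and the crux `TwSourcedInertness` (stmt-1696).
-/

namespace Summit.HubbardSuperconductivity.HubbardSuperconductivity.Theorems

open Summit.HubbardSuperconductivity.HubbardSuperconductivity.Theses.ThermalWedge

/-- **`TwExponentialCeiling` modulo the two remaining inputs** `TwPureThermalBound` and
`TwSourcedInertness` (the other three hypotheses of `TwCeilingGlue` are theorems of the tree). -/
theorem twExponentialCeiling_of_pureThermalBound_of_inertness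
    (hP : TwPureThermalBound) (hI : TwSourcedInertness) : TwExponentialCeiling :=
  twCeilingGlue_proof twSectorEnergyLowerBound_proof hP twApproximatingHamiltonian_proof hI

end Summit.HubbardSuperconductivity.HubbardSuperconductivity.Theorems
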